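import Literature.Analysis.FluidPDE.DivCurlAnnihilator
import Mathlib.Analysis.Calculus.BumpFunction.FiniteDimension
import HarnessLib

/-!
# Crux `ExtremalBiaxialitySubcritical`, negative side: the kinematic decoy, I — the spatial profile

Route `SqueezeCycle`, crux
`Summit.NavierStokesRegularity.NavierStokesRegularity.Theses.SqueezeCycle.ExtremalBiaxialitySubcritical`
(stmt-NavierStokesRegularity-11609). Extracted from the crux work file
`Cruxes/ExtremalBiaxialitySubcritical/Disproof.lean` (cdisprove adversary, generation 4, D-0016).
Part I of the kinematic-decoy construction (`Negative/KinematicDecoy`): the spatial profile.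

* `decoyProfile = W = (∂₀g) e₁ − (∂₁g) e₀`, the tree's curl-type field (`isDivFree_curlPair_of_contDiff`,
  `isTestFunctionOn_curlPair`) of the compactly supported stream function `g = ψ · (x₀x₁ − 2x₁x₂)`
  (`ψ` a `ContDiffBump` `≡ 1` on the unit ball, supported in the ball of radius `2`): smooth,
  compactly supported, divergence free;
* near the origin `W` IS the linear field `L x = (−x₀ + 2x₂, x₁, 0)` (`decoyProfile_eq_of_mem`), so
  `DW(0) = L` (`fderiv_decoyProfile_zero`), with quadratic form `⟪Lz, z⟫ = z₁² − z₀² + 2z₀z₂`;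
* on the orthonormal frame `v = e₁`, `w = (e₀ + e₂)/√2` the form is `α² + β²/2 ≥ ½(α² + β²)`
  (`decoyLin_frame`): the origin is a biaxial (squeeze) point of `W` with middle-eigenvalue value
  `≥ 1/2` in the crux's two-frame currency.

References: Majda–Bertozzi, *Vorticity and Incompressible Flow* (2002) §1.1 (curl-type fields).
-/

noncomputable section

open Set Function Filter MeasureTheory Metric
open scoped RealInnerProductSpace ContDiff Topology

namespace Summit.NavierStokesRegularity.NavierStokesRegularity.Theorems.ExtremalBiaxialitySubcritical.Negative

open Literature.Analysis.FluidPDE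

/-! ### Coordinates and the quadratic stream function -/

/-- Standard basis vector `eᵢ` of `EuclideanSpace ℝ (Fin 3)`. [folklore] -/
def kE (i : Fin 3) : EuclideanSpace ℝ (Fin 3) := EuclideanSpace.single i 1

/-- Coordinates of `eᵢ`. [folklore] -/
@[simp] theorem kE_apply (i j : Fin 3) : kE i j = if j = i then 1 else 0 := by
  simp [kE]

/-- `‖eᵢ‖ = 1`. [folklore] -/
@[simp] theorem norm_kE (i : Fin 3) : ‖kE i‖ = 1 := by simp [kE]

/-- `⟪eᵢ, z⟫ = zᵢ`. [folklore] -/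
@[simp] theorem inner_kE_left (i : Fin 3) (z : EuclideanSpace ℝ (Fin 3)) : ⟪kE i, z⟫ = z i := by
  simp [kE, EuclideanSpace.inner_single_left]

/-- `⟪z, eᵢ⟫ = zᵢ`. [folklore] -/
@[simp] theorem inner_kE_right (i : Fin 3) (z : EuclideanSpace ℝ (Fin 3)) : ⟪z, kE i⟫ = z i := by
  rw [real_inner_comm, inner_kE_left]

/-- The coordinate projections as continuous linear maps. [folklore] -/
abbrev kproj (i : Fin 3) : EuclideanSpace ℝ (Fin 3) →L[ℝ] ℝ := EuclideanSpace.proj i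

/-- The quadratic stream function `P(x) = x₀x₁ − 2x₁x₂`. [folklore] -/
def decoyPoly (x : EuclideanSpace ℝ (Fin 3)) : ℝ := x 0 * x 1 - 2 * (x 1 * x 2)

/-- Its derivative `DP(x) = x₁ dx₀ + (x₀ − 2x₂) dx₁ − 2x₁ dx₂`. [folklore] -/
def decoyPolyDeriv (x : EuclideanSpace ℝ (Fin 3)) : EuclideanSpace ℝ (Fin 3) →L[ℝ] ℝ :=
  (x 1) • kproj 0 + (x 0 - 2 * x 2) • kproj 1 + (-(2 * x 1)) • kproj 2

/-- `DP(x) h = x₁h₀ + (x₀ − 2x₂)h₁ − 2x₁h₂`. [folklore] -/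
theorem decoyPolyDeriv_apply (x h : EuclideanSpace ℝ (Fin 3)) :
    decoyPolyDeriv x h = x 1 * h 0 + (x 0 - 2 * x 2) * h 1 + -(2 * x 1) * h 2 := by
  simp [decoyPolyDeriv]

/-- `P` has derivative `DP`. [folklore] -/
theorem hasFDerivAt_decoyPoly (x : EuclideanSpace ℝ (Fin 3)) :
    HasFDerivAt decoyPoly (decoyPolyDeriv x) x := by
  have h0 : HasFDerivAt (fun y : EuclideanSpace ℝ (Fin 3) => y 0) (kproj 0) x := (kproj 0).hasFDerivAt
  have h1 : HasFDerivAt (fun y : EuclideanSpace ℝ (Fin 3) => y 1) (kproj 1) x := (kproj 1).hasFDerivAt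
  have h2 : HasFDerivAt (fun y : EuclideanSpace ℝ (Fin 3) => y 2) (kproj 2) x := (kproj 2).hasFDerivAt
  have h := (h0.mul h1).sub ((h1.mul h2).const_mul (2 : ℝ))
  refine h.congr_fderiv ?_
  ext v
  simp [decoyPolyDeriv]; ring

/-- `P` is smooth. [folklore] -/
theorem contDiff_decoyPoly : ContDiff ℝ ∞ decoyPoly :=
  ((kproj 0).contDiff.mul (kproj 1).contDiff).sub
    (contDiff_const.mul ((kproj 1).contDiff.mul (kproj 2).contDiff))

/-! ### The bump, the compactly supported stream function and the profile -/

/-- A smooth bump on `ℝ³`: `≡ 1` on the closed unit ball, supported in the ball of radius `2`. [folklore] -/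
def decoyBump : ContDiffBump (0 : EuclideanSpace ℝ (Fin 3)) := ⟨1, 2, one_pos, one_lt_two⟩

/-- The compactly supported stream function `g = ψ · P`. [folklore] -/
def decoyG (x : EuclideanSpace ℝ (Fin 3)) : ℝ := decoyBump x * decoyPoly x

/-- `g` is smooth. [folklore] -/
theorem contDiff_decoyG : ContDiff ℝ ∞ decoyG :=
  decoyBump.contDiff.mul contDiff_decoyPoly

/-- `g` has compact support. [folklore] -/
theorem hasCompactSupport_decoyG : HasCompactSupport decoyG :=
  decoyBump.hasCompactSupport.mul_right

/-- `g` is a test function on `ℝ³`. [folklore] -/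
theorem isTestFunctionOn_decoyG :
    Literature.Analysis.FunctionSpaces.IsTestFunctionOn (⊤ : TopologicalSpace.Opens (EuclideanSpace ℝ (Fin 3))) decoyG :=
  ⟨contDiff_decoyG, hasCompactSupport_decoyG, by simp⟩

/-- On the open unit ball `g = P` (germ-wise). [folklore] -/
theorem decoyG_eventuallyEq {x : EuclideanSpace ℝ (Fin 3)} (hx : x ∈ ball (0 : EuclideanSpace ℝ (Fin 3)) 1) :
    decoyG =ᶠ[𝓝 x] decoyPoly := by
  have hx' : x ∈ ball (0 : EuclideanSpace ℝ (Fin 3)) decoyBump.rIn := hx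
  filter_upwards [decoyBump.eventuallyEq_one_of_mem_ball hx'] with y hy
  simp only [decoyG, hy, Pi.one_apply, one_mul]

/-- On the open unit ball `Dg = DP`. [folklore] -/
theorem fderiv_decoyG {x : EuclideanSpace ℝ (Fin 3)} (hx : x ∈ ball (0 : EuclideanSpace ℝ (Fin 3)) 1) :
    fderiv ℝ decoyG x = decoyPolyDeriv x := by
  rw [(decoyG_eventuallyEq hx).fderiv_eq]
  exact (hasFDerivAt_decoyPoly x).fderiv

/-- **The spatial profile** `W = (∂₀ g) e₁ − (∂₁ g) e₀`, the tree's curl-type field of `g`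
(`isDivFree_curlPair_of_contDiff`): smooth, compactly supported, divergence free. [folklore] -/
def decoyProfile (x : EuclideanSpace ℝ (Fin 3)) : EuclideanSpace ℝ (Fin 3) :=
  fderiv ℝ decoyG x (kE 0) • kE 1 - fderiv ℝ decoyG x (kE 1) • kE 0

/-- `W` is a (vector) test function. [folklore] -/
theorem isTestFunctionOn_decoyProfile :
    Literature.Analysis.FunctionSpaces.IsTestFunctionOn (⊤ : TopologicalSpace.Opens (EuclideanSpace ℝ (Fin 3))) decoyProfile :=
  isTestFunctionOn_curlPair isTestFunctionOn_decoyG (kE 0) (kE 1)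

/-- `W` is smooth. [folklore] -/
theorem contDiff_decoyProfile : ContDiff ℝ ∞ decoyProfile :=
  isTestFunctionOn_decoyProfile.contDiff

/-- `W` has compact support. [folklore] -/
theorem hasCompactSupport_decoyProfile : HasCompactSupport decoyProfile :=
  isTestFunctionOn_decoyProfile.hasCompactSupport

/-- `div W = 0` (Schwarz). [folklore] -/
theorem isDivFree_decoyProfile : VectorCalculus.IsDivFree decoyProfile :=
  isDivFree_curlPair_of_contDiff (contDiff_infty.1 contDiff_decoyG 2) (kE 0) (kE 1)

/-- `W` is continuous. [folklore] -/
theorem continuous_decoyProfile : Continuous decoyProfile := contDiff_decoyProfile.continuous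

/-- `DW` is continuous. [folklore] -/
theorem continuous_fderiv_decoyProfile : Continuous (fderiv ℝ decoyProfile) :=
  contDiff_decoyProfile.continuous_fderiv (by simp)

/-- The linear model `L h = h₁ e₁ − (h₀ − 2h₂) e₀` of `W` near the origin. [folklore] -/
def decoyLin : EuclideanSpace ℝ (Fin 3) →L[ℝ] EuclideanSpace ℝ (Fin 3) :=
  (kproj 1).smulRight (kE 1) - (kproj 0 - (2 : ℝ) • kproj 2).smulRight (kE 0)

/-- `L h = h₁ e₁ − (h₀ − 2h₂) e₀`. [folklore] -/
theorem decoyLin_apply (h : EuclideanSpace ℝ (Fin 3)) :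
    decoyLin h = (h 1) • kE 1 - (h 0 - 2 * h 2) • kE 0 := by
  simp [decoyLin, ContinuousLinearMap.smulRight_apply, smul_eq_mul]

/-- On the open unit ball `W = L`. [folklore] -/
theorem decoyProfile_eq_of_mem {x : EuclideanSpace ℝ (Fin 3)} (hx : x ∈ ball (0 : EuclideanSpace ℝ (Fin 3)) 1) :
    decoyProfile x = decoyLin x := by
  rw [decoyProfile, fderiv_decoyG hx, decoyLin_apply, decoyPolyDeriv_apply, decoyPolyDeriv_apply]
  simp

/-- `W = L` germ-wise at the origin. [folklore] -/
theorem decoyProfile_eventuallyEq : decoyProfile =ᶠ[𝓝 (0 : EuclideanSpace ℝ (Fin 3))] decoyLin := by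
  filter_upwards [Metric.isOpen_ball.mem_nhds (Metric.mem_ball_self (one_pos : (0 : ℝ) < 1))] with x hx
  exact decoyProfile_eq_of_mem hx

/-- `DW(0) = L`. [folklore] -/
theorem fderiv_decoyProfile_zero : fderiv ℝ decoyProfile 0 = decoyLin := by
  rw [decoyProfile_eventuallyEq.fderiv_eq]
  exact decoyLin.fderiv

/-- The quadratic form of `L`: `⟪L z, z⟫ = z₁² − z₀² + 2 z₀ z₂`. [folklore] -/
theorem inner_decoyLin (z : EuclideanSpace ℝ (Fin 3)) :
    ⟪decoyLin z, z⟫ = z 1 ^ 2 - z 0 ^ 2 + 2 * (z 0 * z 2) := by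
  rw [decoyLin_apply, inner_sub_left, real_inner_smul_left, real_inner_smul_left, inner_kE_left,
    inner_kE_left]
  ring

/-! ### The biaxial frame at the origin -/

/-- First frame vector `v = e₁`. [folklore] -/
def frameV : EuclideanSpace ℝ (Fin 3) := kE 1

/-- Second frame vector `w = (e₀ + e₂)/√2`. [folklore] -/
def frameW : EuclideanSpace ℝ (Fin 3) := (Real.sqrt 2)⁻¹ • (kE 0 + kE 2)

/-- `‖e₀ + e₂‖ = √2`. [folklore] -/
theorem norm_kE_zero_add_kE_two : ‖kE 0 + kE 2‖ = Real.sqrt 2 := by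
  rw [EuclideanSpace.norm_eq]
  congr 1
  simp [Fin.sum_univ_three]
  norm_num

/-- `‖v‖ = 1`. [folklore] -/
theorem norm_frameV : ‖frameV‖ = 1 := norm_kE 1

/-- `‖w‖ = 1`. [folklore] -/
theorem norm_frameW : ‖frameW‖ = 1 := by
  have h2 : (0 : ℝ) < Real.sqrt 2 := Real.sqrt_pos.2 (by norm_num)
  rw [frameW, norm_smul, norm_inv, Real.norm_of_nonneg h2.le, norm_kE_zero_add_kE_two,
    inv_mul_cancel₀ h2.ne']

/-- `⟪v, w⟫ = 0`. [folklore] -/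
theorem inner_frameV_frameW : ⟪frameV, frameW⟫ = 0 := by
  simp [frameV, frameW]

/-- Coordinates of `α v + β w`: `(β/√2, α, β/√2)`. [folklore] -/
theorem frame_coords (α β : ℝ) :
    (α • frameV + β • frameW) 0 = β * (Real.sqrt 2)⁻¹ ∧ (α • frameV + β • frameW) 1 = α ∧
      (α • frameV + β • frameW) 2 = β * (Real.sqrt 2)⁻¹ := by
  refine ⟨?_, ?_, ?_⟩ <;> simp [frameV, frameW]

/-- **The frame inequality**: `⟪L z, z⟫ ≥ ½ |z|²` on the plane `span{v, w}` (there
`⟪L z, z⟫ = α² + β²/2`). [folklore] -/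
theorem decoyLin_frame (α β : ℝ) :
    (1 / 2 : ℝ) * (α ^ 2 + β ^ 2) ≤ ⟪decoyLin (α • frameV + β • frameW), α • frameV + β • frameW⟫ := by
  obtain ⟨h0, h1, h2⟩ := frame_coords α β
  rw [inner_decoyLin, h0, h1, h2]
  have hs : (Real.sqrt 2)⁻¹ ^ 2 = 2⁻¹ := by
    rw [inv_pow, Real.sq_sqrt (by norm_num : (0 : ℝ) ≤ 2)]
  nlinarith [hs, sq_nonneg α, sq_nonneg β]

end Summit.NavierStokesRegularity.NavierStokesRegularity.Theorems.ExtremalBiaxialitySubcritical.Negative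

end
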